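import Mathlib
import Literature.Analysis.Convex.GeneralizedInequalityCentralPath
import HarnessLib

/-!
# Minimal elements, dual characterization and scalarization of vector optimization problems
(Boyd–Vandenberghe, *Convex Optimization*, §2.4.1–2.4.2, §2.6.2–2.6.3, §3.6.2, §4.7.2–4.7.5)

Source: S. Boyd, L. Vandenberghe, *Convex Optimization*, Cambridge University Press (2004)
[cite: BoydVandenberghe2004] — held copy read: §2.4.1 (generalized inequality `x ⪯_K y ⟺
y − x ∈ K` and its properties), §2.4.2 (minimum and minimal elements of a set w.r.t. `⪯_K`,
uniqueness of the minimum element, the set descriptions `S ⊆ x + K` and `(x − K) ∩ S = {x}`),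
§2.6.2 (dual generalized inequalities: `x ⪯_K y` iff `λᵀx ≤ λᵀy` for all `λ ⪰_{K*} 0`),
§2.6.3 (dual characterization of the minimum element — `x` is the minimum element of `S` iff
for every `λ ≻_{K*} 0` it minimises `λᵀz` over `S`, uniquely — and of minimal elements:
`λ ≻_{K*} 0` and `x` minimises `λᵀz` over `S` ⇒ `x` minimal; for convex `S` every minimal
`x` minimises some nonzero `λ ⪰_{K*} 0`), §3.6.2 (`K`-convex functions and their dual
characterization), §4.7.2 (optimal points: `O ⊆ f₀(x⋆) + K`, (4.57)), §4.7.3 (Pareto optimal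
points: `(f₀(x) − K) ∩ O = {f₀(x)}`, (4.59)), §4.7.4 (scalarization (4.60): a minimiser of
`λᵀf₀` with `λ ≻_{K*} 0` is Pareto optimal; the unachievable halfspace (4.61); the partial
converse for convex problems via `A = O + K`, (4.62), and the caveat that a nonzero
`λ ⪰_{K*} 0` need not produce Pareto optimal points), §4.7.5 (multicriterion optimization,
`K = ℝ^q_+`: Pareto optimal = not dominated, optimal = simultaneously optimal for every
objective, positive weight vectors).

## Setting and typing choices

* The cone is a Mathlib `PointedCone ℝ E` (a convex cone containing `0`) in a real vector space
  `E`; `x ⪯_K y` is the explicit predicate `KLE K x y := y - x ∈ K` (no order instance is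
  declared).  "Pointed" in the book's sense (`K ∩ −K = {0}`) is Mathlib's
  `ConvexCone.Salient` of the underlying convex cone and is assumed only where it is used.
* Dual vectors `λ` are linear functionals `φ : E →ₗ[ℝ] ℝ`; `λ ⪰_{K*} 0` is `DualNonneg K φ`
  (`∀ k ∈ K, 0 ≤ φ k`, i.e. membership in Mathlib's `PointedCone.dual (Module.Dual.eval ℝ E) K`,
  see `dualNonneg_iff_mem_dual`) and `λ ≻_{K*} 0` is `DualPos K φ` (`φ k > 0` for every nonzero
  `k ∈ K`; for a proper cone in `ℝⁿ` this is `λ ∈ int K*`).  The separation arguments of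
  §2.6.2–2.6.3 are carried out in a real topological vector space (locally convex where the
  bipolar direction is needed) and produce continuous functionals `E →L[ℝ] ℝ`, using Mathlib's
  geometric Hahn–Banach theorems.
* The book's standing assumption "`K` proper" is split into the hypotheses each statement
  actually uses: closedness (`IsClosed (K : Set E)`), solidity (`(interior K).Nonempty`),
  pointedness (`Salient`), and — for the converse half of the minimum-element
  characterization — the existence of one strictly positive dual functional.
* A vector optimization problem is given by a feasible set `F : Set X` and an objective
  `f : X → E`; `O = f '' F` is the set of achievable objective values.

## Relation to the tree

Mathlib provides `PointedCone`, `ConvexCone.Salient`, `PointedCone.dual`/`ProperCone.dual` and the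
bipolar theorem for proper cones in inner product spaces (`ProperCone.hyperplane_separation`),
but no notion of minimum/minimal element with respect to a cone, no Pareto optimality and no
scalarization results.  In `Literature/Analysis/Convex`, `GeneralizedInequalityCentralPath.lean`
(namespace `ConicCentralPath`, imported) has the inner-product-space forms `InDualCone K y`
(`y ∈ K*` for a set `K`) and `KConvexOn K D f` with the forward dual characterization
`KConvexOn.convexOn_inner`, and lists the converse characterization as not formalised; the
present file works in a general real (topological) vector space with a `PointedCone` and linear
functionals, proves that converse (`coneConvexOn_of_forall_dualNonneg`), and records that the two
settings agree where both make sense (`dualNonneg_innerSL_iff_inDualCone`,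
`coneConvexOn_iff_kConvexOn`).  The other convex-analysis files of the directory
(`FarkasMinkowskiWeyl`, `LinearProgrammingDuality`, `SecondOrderConePrograms`, `ConeLift`, …)
contain nothing on vector optimization.
-/

namespace Literature.Analysis.Convex.VectorOptimizationScalarization

open Set
open scoped Pointwise

/-! ## §2.4.1 The generalized inequality of a cone -/

section GeneralizedInequality

variable {E : Type*} [AddCommGroup E] [Module ℝ E]

/-- The generalized inequality `x ⪯_K y` induced by a cone `K`: `y − x ∈ K`.
[cite: BoydVandenberghe2004, §2.4.1] -/
def KLE (K : PointedCone ℝ E) (x y : E) : Prop := y - x ∈ K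

variable (K : PointedCone ℝ E)

/-- [cite: BoydVandenberghe2004, §2.4.1] -/
theorem kle_iff {x y : E} : KLE K x y ↔ y - x ∈ K := Iff.rfl

/-- `0 ⪯_K k` iff `k ∈ K`. [cite: BoydVandenberghe2004, §2.4.1] -/
theorem kle_zero_iff {k : E} : KLE K 0 k ↔ k ∈ K := by simp [KLE]

/-- `⪯_K` is reflexive. [cite: BoydVandenberghe2004, §2.4.1] -/
theorem kle_refl (x : E) : KLE K x x := by simp [KLE]

/-- `⪯_K` is transitive. [cite: BoydVandenberghe2004, §2.4.1] -/
theorem kle_trans {x y z : E} (h₁ : KLE K x y) (h₂ : KLE K y z) : KLE K x z := by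
  unfold KLE at *
  have : z - x = (z - y) + (y - x) := by abel
  rw [this]
  exact add_mem h₂ h₁

/-- `⪯_K` is preserved under addition. [cite: BoydVandenberghe2004, §2.4.1] -/
theorem kle_add {x y u v : E} (h₁ : KLE K x y) (h₂ : KLE K u v) : KLE K (x + u) (y + v) := by
  unfold KLE at *
  have : y + v - (x + u) = (y - x) + (v - u) := by abel
  rw [this]
  exact add_mem h₁ h₂

/-- `⪯_K` is preserved under nonnegative scaling. [cite: BoydVandenberghe2004, §2.4.1] -/
theorem kle_smul {x y : E} {c : ℝ} (hc : 0 ≤ c) (h : KLE K x y) : KLE K (c • x) (c • y) := by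
  unfold KLE at *
  rw [← smul_sub]
  exact K.smul_mem hc h

/-- [folklore] In a salient cone, `v ∈ K` and `−v ∈ K` force `v = 0`. -/
private theorem eq_zero_of_mem_of_neg_mem {K : PointedCone ℝ E}
    (hK : (K : ConvexCone ℝ E).Salient) {v : E} (hv : v ∈ K) (hnv : -v ∈ K) : v = 0 := by
  by_contra h
  exact hK v hv h hnv

/-- `⪯_K` is antisymmetric when `K` is pointed (salient).
[cite: BoydVandenberghe2004, §2.4.1] -/
theorem kle_antisymm (hK : (K : ConvexCone ℝ E).Salient) {x y : E} (h₁ : KLE K x y)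
    (h₂ : KLE K y x) : x = y := by
  have hneg : -(y - x) ∈ K := by rw [neg_sub]; exact h₂
  have h0 : y - x = 0 := eq_zero_of_mem_of_neg_mem hK h₁ hneg
  exact (sub_eq_zero.mp h0).symm

end GeneralizedInequality

/-! ## §2.4.2 Minimum and minimal elements -/

section MinimalElements

variable {E : Type*} [AddCommGroup E] [Module ℝ E]

/-- `x` is the **minimum element** of `S` w.r.t. `⪯_K`: `x ∈ S` and `x ⪯_K y` for every
`y ∈ S`. [cite: BoydVandenberghe2004, §2.4.2] -/
def IsMinimumElt (K : PointedCone ℝ E) (S : Set E) (x : E) : Prop :=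
  x ∈ S ∧ ∀ y ∈ S, KLE K x y

/-- `x` is a **minimal element** of `S` w.r.t. `⪯_K`: `x ∈ S` and `y ∈ S`, `y ⪯_K x` only if
`y = x`. [cite: BoydVandenberghe2004, §2.4.2] -/
def IsMinimalElt (K : PointedCone ℝ E) (S : Set E) (x : E) : Prop :=
  x ∈ S ∧ ∀ y ∈ S, KLE K y x → y = x

variable (K : PointedCone ℝ E) {S : Set E} {x y : E}

/-- If a set has a minimum element (w.r.t. a pointed cone), it is unique.
[cite: BoydVandenberghe2004, §2.4.2] -/
theorem IsMinimumElt.unique (hK : (K : ConvexCone ℝ E).Salient) (hx : IsMinimumElt K S x)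
    (hy : IsMinimumElt K S y) : x = y :=
  kle_antisymm K hK (hx.2 y hy.1) (hy.2 x hx.1)

/-- Set description of the minimum element: `x ∈ S` is the minimum element of `S` iff
`S ⊆ x + K`. [cite: BoydVandenberghe2004, §2.4.2] -/
theorem isMinimumElt_iff_subset_vadd :
    IsMinimumElt K S x ↔ x ∈ S ∧ S ⊆ x +ᵥ (K : Set E) := by
  refine and_congr_right fun _ => forall₂_congr fun z _ => ?_
  rw [Set.mem_vadd_set_iff_neg_vadd_mem, vadd_eq_add, neg_add_eq_sub]
  rfl

/-- Set description of minimal elements: `x ∈ S` is a minimal element of `S` iff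
`(x − K) ∩ S = {x}`. [cite: BoydVandenberghe2004, §2.4.2] -/
theorem isMinimalElt_iff_inter_eq_singleton :
    IsMinimalElt K S x ↔ x ∈ S ∧ (x +ᵥ -(K : Set E)) ∩ S = {x} := by
  have hmem : ∀ z : E, z ∈ x +ᵥ -(K : Set E) ↔ KLE K z x := by
    intro z
    rw [Set.mem_vadd_set_iff_neg_vadd_mem, Set.mem_neg, vadd_eq_add, neg_add_eq_sub, neg_sub]
    rfl
  constructor
  · rintro ⟨hx, h⟩
    refine ⟨hx, Set.eq_singleton_iff_unique_mem.mpr ⟨⟨(hmem x).mpr (kle_refl K x), hx⟩, ?_⟩⟩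
    rintro z ⟨hz, hzS⟩
    exact h z hzS ((hmem z).mp hz)
  · rintro ⟨hx, h⟩
    refine ⟨hx, fun z hzS hzx => ?_⟩
    have hz : z ∈ (x +ᵥ -(K : Set E)) ∩ S := ⟨(hmem z).mpr hzx, hzS⟩
    rw [h] at hz
    exact hz

/-- A minimum element is a minimal element (pointed cone).
[cite: BoydVandenberghe2004, §2.4.2] -/
theorem IsMinimumElt.isMinimalElt (hK : (K : ConvexCone ℝ E).Salient)
    (hx : IsMinimumElt K S x) : IsMinimalElt K S x :=
  ⟨hx.1, fun y hy hyx => kle_antisymm K hK hyx (hx.2 y hy)⟩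

/-- If `S` has a minimum element `x`, then `x` is its only minimal element.
[cite: BoydVandenberghe2004, §2.4.2] -/
theorem IsMinimalElt.eq_of_isMinimumElt (hy : IsMinimalElt K S y) (hx : IsMinimumElt K S x) :
    y = x :=
  (hy.2 x hx.1 (hx.2 y hy.1)).symm

end MinimalElements

/-! ## §2.6.2 Dual generalized inequalities (algebraic part) -/

section Dual

variable {E : Type*} [AddCommGroup E] [Module ℝ E]

/-- `λ ⪰_{K*} 0`: the functional `φ` is nonnegative on `K` (membership in the dual cone).
[cite: BoydVandenberghe2004, §2.6.1 (2.19)] -/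
def DualNonneg (K : PointedCone ℝ E) (φ : E →ₗ[ℝ] ℝ) : Prop := ∀ k ∈ K, 0 ≤ φ k

/-- `λ ≻_{K*} 0`: the functional `φ` is positive on `K ∖ {0}` (for a proper cone in `ℝⁿ` this is
`λ ∈ int K*`). [cite: BoydVandenberghe2004, §2.6.2] -/
def DualPos (K : PointedCone ℝ E) (φ : E →ₗ[ℝ] ℝ) : Prop := ∀ k ∈ K, k ≠ 0 → 0 < φ k

variable (K : PointedCone ℝ E) {φ ψ : E →ₗ[ℝ] ℝ}

/-- `DualNonneg K φ` is membership of `φ` in Mathlib's dual cone of `K` for the evaluation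
pairing. [cite: BoydVandenberghe2004, §2.6.1 (2.19)] -/
theorem dualNonneg_iff_mem_dual :
    DualNonneg K φ ↔ φ ∈ PointedCone.dual (Module.Dual.eval ℝ E) (K : Set E) := by
  simp only [DualNonneg, PointedCone.mem_dual, SetLike.mem_coe, Module.Dual.eval_apply]

/-- [cite: BoydVandenberghe2004, §2.6.2] -/
theorem DualPos.dualNonneg (h : DualPos K φ) : DualNonneg K φ := by
  intro k hk
  by_cases h0 : k = 0
  · simp [h0]
  · exact (h k hk h0).le

/-- The dual cone is a convex cone: closed under addition.
[cite: BoydVandenberghe2004, §2.6.1] -/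
theorem DualNonneg.add (h₁ : DualNonneg K φ) (h₂ : DualNonneg K ψ) : DualNonneg K (φ + ψ) :=
  fun k hk => by simpa using add_nonneg (h₁ k hk) (h₂ k hk)

/-- The dual cone is a convex cone: closed under nonnegative scaling.
[cite: BoydVandenberghe2004, §2.6.1] -/
theorem DualNonneg.smul (h : DualNonneg K φ) {t : ℝ} (ht : 0 ≤ t) : DualNonneg K (t • φ) :=
  fun k hk => by simpa using mul_nonneg ht (h k hk)

/-- A nonnegative dual functional plus a positive multiple of a strictly positive one is strictly
positive (used in the converse of the minimum-element characterization, §2.6.3).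
[cite: BoydVandenberghe2004, §2.6.3] -/
theorem DualNonneg.add_smul_dualPos (h₁ : DualNonneg K φ) (h₂ : DualPos K ψ) {t : ℝ}
    (ht : 0 < t) : DualPos K (φ + t • ψ) := by
  intro k hk hk0
  have := mul_pos ht (h₂ k hk hk0)
  have h0 := h₁ k hk
  simp only [LinearMap.add_apply, LinearMap.smul_apply, smul_eq_mul]
  linarith

/-- `x ⪯_K y` implies `λᵀx ≤ λᵀy` for every `λ ⪰_{K*} 0` (the forward half of the first bullet
of §2.6.2). [cite: BoydVandenberghe2004, §2.6.2] -/
theorem KLE.map_le {x y : E} (h : KLE K x y) (hφ : DualNonneg K φ) : φ x ≤ φ y := by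
  have := hφ _ h
  rwa [map_sub, sub_nonneg] at this

/-- `x ≺ y` in the sense `y − x ∈ K ∖ {0}` implies `λᵀx < λᵀy` for every `λ ≻_{K*} 0`.
[cite: BoydVandenberghe2004, §2.6.2] -/
theorem KLE.map_lt {x y : E} (h : KLE K x y) (hne : x ≠ y) (hφ : DualPos K φ) : φ x < φ y := by
  have := hφ _ h (sub_ne_zero.mpr (Ne.symm hne))
  rwa [map_sub, sub_pos] at this

/-! ## §2.6.3 Minimum and minimal elements via dual inequalities (algebraic halves) -/

variable {S : Set E} {x : E}

/-- Dual characterization of the minimum element, necessity: if `x` is the minimum element of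
`S` then for every `λ ≻_{K*} 0`, `x` is the **unique** minimiser of `λᵀz` over `z ∈ S`
(no convexity of `S` needed). [cite: BoydVandenberghe2004, §2.6.3] -/
theorem IsMinimumElt.lt_of_dualPos (hx : IsMinimumElt K S x) (hφ : DualPos K φ) {z : E}
    (hz : z ∈ S) (hzx : z ≠ x) : φ x < φ z :=
  (hx.2 z hz).map_lt K (Ne.symm hzx) hφ

/-- A minimum element minimises every `λ ⪰_{K*} 0` over `S`.
[cite: BoydVandenberghe2004, §2.6.3] -/
theorem IsMinimumElt.le_of_dualNonneg (hx : IsMinimumElt K S x) (hφ : DualNonneg K φ) {z : E}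
    (hz : z ∈ S) : φ x ≤ φ z :=
  (hx.2 z hz).map_le K hφ

/-- Dual characterization of minimal elements, the sufficient condition: if `λ ≻_{K*} 0` and
`x` minimises `λᵀz` over `z ∈ S`, then `x` is a minimal element of `S` (no convexity and no
pointedness needed). [cite: BoydVandenberghe2004, §2.6.3] -/
theorem isMinimalElt_of_dualPos (hφ : DualPos K φ) (hx : x ∈ S)
    (hmin : ∀ z ∈ S, φ x ≤ φ z) : IsMinimalElt K S x := by
  refine ⟨hx, fun y hy hyx => ?_⟩
  by_contra hne
  have h := hyx.map_lt K hne hφ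
  exact absurd (hmin y hy) (not_le.mpr h)

end Dual

/-! ## §2.6.2–2.6.3 Topological halves (separation arguments) -/

section Topological

variable {E : Type*} [AddCommGroup E] [Module ℝ E] [TopologicalSpace E]
  [IsTopologicalAddGroup E] [ContinuousSMul ℝ E]
variable {K : PointedCone ℝ E}

omit [IsTopologicalAddGroup E] in
/-- The interior of a cone is invariant under positive scaling.
[cite: BoydVandenberghe2004, §2.4.1] -/
theorem cone_smul_mem_interior {k : E} (hk : k ∈ interior (K : Set E)) {t : ℝ} (ht : 0 < t) :
    t • k ∈ interior (K : Set E) := by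
  have h1 : t • interior (K : Set E) ⊆ (K : Set E) := by
    rintro _ ⟨v, hv, rfl⟩
    exact K.smul_mem ht.le (interior_subset hv)
  have h2 : IsOpen (t • interior (K : Set E)) := isOpen_interior.smul₀ ht.ne'
  exact interior_maximal h1 h2 (Set.smul_mem_smul_set hk)

omit [IsTopologicalAddGroup E] in
/-- [folklore] A salient cone in a nontrivial space does not contain `0` in its interior. -/
private theorem zero_notMem_interior [Nontrivial E] (hK : (K : ConvexCone ℝ E).Salient) :
    (0 : E) ∉ interior (K : Set E) := by
  intro h0
  obtain ⟨v, hv⟩ := exists_ne (0 : E)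
  have hc : Continuous fun t : ℝ => t • v := continuous_id.smul continuous_const
  have hmem : ∀ᶠ t in nhds (0 : ℝ), t • v ∈ interior (K : Set E) := by
    have ht : Filter.Tendsto (fun t : ℝ => t • v) (nhds 0) (nhds 0) := by
      simpa using hc.tendsto 0
    exact ht (isOpen_interior.mem_nhds h0)
  obtain ⟨ε, hε, hball⟩ := Metric.eventually_nhds_iff.mp hmem
  have hε2 : 0 < ε / 2 := half_pos hε
  have hd1 : dist (ε / 2) 0 < ε := by
    rw [dist_zero_right, Real.norm_eq_abs, abs_of_pos hε2]; linarith
  have hd2 : dist (-(ε / 2)) 0 < ε := by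
    rw [dist_zero_right, Real.norm_eq_abs, abs_neg, abs_of_pos hε2]; linarith
  have h1 : (ε / 2) • v ∈ K := interior_subset (hball hd1)
  have h2 : (ε / 2) • (-v) ∈ K := by
    rw [smul_neg, ← neg_smul]
    exact interior_subset (hball hd2)
  have hvK : v ∈ K := (K.smul_mem_iff hε2).mp h1
  have hnvK : -v ∈ K := (K.smul_mem_iff hε2).mp h2
  exact hv (eq_zero_of_mem_of_neg_mem hK hvK hnvK)

/-- Supporting functional at a point outside a closed cone: if `v ∉ K` (closed, in a locally
convex space) there is a continuous `λ ⪰_{K*} 0` with `λᵀv < 0` — the separation step in the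
converse arguments of §2.6.2–2.6.3. [cite: BoydVandenberghe2004, §2.6.3] -/
theorem exists_dualNonneg_apply_neg [LocallyConvexSpace ℝ E] (hKc : IsClosed (K : Set E))
    {v : E} (hv : v ∉ K) :
    ∃ f : E →L[ℝ] ℝ, DualNonneg K (f : E →ₗ[ℝ] ℝ) ∧ f v < 0 := by
  obtain ⟨f, u, hfv, hfK⟩ := geometric_hahn_banach_point_closed K.convex hKc hv
  have hu : u < 0 := by simpa using hfK 0 K.zero_mem
  refine ⟨f, fun k hk => ?_, hfv.trans hu⟩
  show 0 ≤ f k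
  by_contra hneg
  push Not at hneg
  have ht : 0 < u / f k := div_pos_of_neg_of_neg hu hneg
  have hmem : (u / f k) • k ∈ K := K.smul_mem ht.le hk
  have h := hfK _ hmem
  rw [map_smul, smul_eq_mul, div_mul_cancel₀ _ hneg.ne] at h
  exact lt_irrefl _ h

/-- Dual generalized inequalities, the converse half of the first bullet of §2.6.2: for a closed
cone, if `λᵀx ≤ λᵀy` for every continuous `λ ⪰_{K*} 0` then `x ⪯_K y`.
[cite: BoydVandenberghe2004, §2.6.2] -/
theorem kle_of_forall_dualNonneg [LocallyConvexSpace ℝ E] (hKc : IsClosed (K : Set E))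
    {x y : E} (h : ∀ f : E →L[ℝ] ℝ, DualNonneg K (f : E →ₗ[ℝ] ℝ) → f x ≤ f y) :
    KLE K x y := by
  by_contra hxy
  obtain ⟨f, hf, hneg⟩ := exists_dualNonneg_apply_neg hKc hxy
  have := h f hf
  rw [map_sub] at hneg
  linarith

/-- `x ⪯_K y` iff `λᵀx ≤ λᵀy` for all continuous `λ ⪰_{K*} 0` (closed cone, locally convex
space). [cite: BoydVandenberghe2004, §2.6.2] -/
theorem kle_iff_forall_dualNonneg [LocallyConvexSpace ℝ E] (hKc : IsClosed (K : Set E))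
    {x y : E} : KLE K x y ↔ ∀ f : E →L[ℝ] ℝ, DualNonneg K (f : E →ₗ[ℝ] ℝ) → f x ≤ f y :=
  ⟨fun h _ hf => h.map_le K hf, kle_of_forall_dualNonneg hKc⟩

/-- Dual characterization of the minimum element, sufficiency: for a closed cone admitting a
strictly positive continuous dual functional, if `x ∈ S` minimises `λᵀz` over `S` for every
continuous `λ ≻_{K*} 0`, then `x` is the minimum element of `S` (the book assumes the unique
minimiser; minimiser suffices).  Proof as in the book: a `z ∈ S` with `z ⋡_K x` is separated
from `K` by some `λ̃ ⪰_{K*} 0`, and `λ̃ + tλ₀ ≻_{K*} 0` for small `t > 0` still has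
`λᵀ(z − x) < 0`. [cite: BoydVandenberghe2004, §2.6.3] -/
theorem isMinimumElt_of_forall_dualPos [LocallyConvexSpace ℝ E] (hKc : IsClosed (K : Set E))
    (h₀ : ∃ φ₀ : E →L[ℝ] ℝ, DualPos K (φ₀ : E →ₗ[ℝ] ℝ)) {S : Set E} {x : E} (hx : x ∈ S)
    (h : ∀ φ : E →L[ℝ] ℝ, DualPos K (φ : E →ₗ[ℝ] ℝ) → ∀ z ∈ S, φ x ≤ φ z) :
    IsMinimumElt K S x := by
  refine ⟨hx, fun z hz => ?_⟩
  by_contra hzx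
  obtain ⟨φ₀, hφ₀⟩ := h₀
  obtain ⟨f, hf, hneg⟩ := exists_dualNonneg_apply_neg hKc hzx
  obtain ⟨t, ht, hlt⟩ : ∃ t : ℝ, 0 < t ∧ f (z - x) + t * φ₀ (z - x) < 0 := by
    by_cases hp : φ₀ (z - x) ≤ 0
    · exact ⟨1, one_pos, by linarith⟩
    · push Not at hp
      refine ⟨-f (z - x) / (2 * φ₀ (z - x)), div_pos (by linarith) (by linarith), ?_⟩
      have : -f (z - x) / (2 * φ₀ (z - x)) * φ₀ (z - x) = -f (z - x) / 2 := by
        field_simp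
      rw [this]
      linarith
  have hψ : DualPos K ((f + t • φ₀ : E →L[ℝ] ℝ) : E →ₗ[ℝ] ℝ) := by
    intro k hk hk0
    have h1 : 0 ≤ f k := hf k hk
    have h2 : 0 < t * φ₀ k := mul_pos ht (hφ₀ k hk hk0)
    show 0 < f k + t • φ₀ k
    rw [smul_eq_mul]
    linarith
  have hxz : f x + t * φ₀ x ≤ f z + t * φ₀ z := by simpa using h _ hψ z hz
  rw [map_sub, map_sub, mul_sub] at hlt
  rw [map_sub] at hneg
  linarith

/-- Dual characterization of minimal elements, the necessary condition for **convex** `S`: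
if `K` is solid and pointed and `x` is a minimal element of the convex set `S`, there is a
nonzero continuous `λ ⪰_{K*} 0` such that `x` minimises `λᵀz` over `z ∈ S`.  (Separate the
open convex set `x − int K` from `S`.)  The book notes the conclusion cannot be strengthened to
`λ ≻_{K*} 0`. [cite: BoydVandenberghe2004, §2.6.3] -/
theorem IsMinimalElt.exists_dualNonneg [Nontrivial E] (hK : (K : ConvexCone ℝ E).Salient)
    (hKi : (interior (K : Set E)).Nonempty) {S : Set E} (hS : Convex ℝ S) {x : E}
    (hx : IsMinimalElt K S x) :
    ∃ f : E →L[ℝ] ℝ, f ≠ 0 ∧ DualNonneg K (f : E →ₗ[ℝ] ℝ) ∧ ∀ z ∈ S, f x ≤ f z := by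
  have hKc : Convex ℝ (interior (K : Set E)) := K.convex.interior
  set D : Set E := (fun k => x - k) '' interior (K : Set E) with hD
  have hDopen : IsOpen D := isOpenMap_sub_left x _ isOpen_interior
  have hDconv : Convex ℝ D := by
    intro a ha b hb θ₁ θ₂ hθ₁ hθ₂ hθ
    obtain ⟨k₁, hk₁, rfl⟩ := ha
    obtain ⟨k₂, hk₂, rfl⟩ := hb
    refine ⟨θ₁ • k₁ + θ₂ • k₂, hKc hk₁ hk₂ hθ₁ hθ₂ hθ, ?_⟩
    calc x - (θ₁ • k₁ + θ₂ • k₂) = (θ₁ + θ₂) • x - (θ₁ • k₁ + θ₂ • k₂) := by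
          rw [hθ, one_smul]
      _ = θ₁ • (x - k₁) + θ₂ • (x - k₂) := by
          simp only [add_smul, smul_sub]; abel
  have hdisj : Disjoint D S := by
    rw [Set.disjoint_left]
    rintro _ ⟨k, hk, rfl⟩ hzS
    have hk' : KLE K (x - k) x := by
      show x - (x - k) ∈ K
      rw [sub_sub_cancel]
      exact interior_subset hk
    have h := hx.2 _ hzS hk'
    have hk0 : k = 0 := by simpa using h
    exact zero_notMem_interior hK (hk0 ▸ hk)
  obtain ⟨f, u, hfD, hfS⟩ := geometric_hahn_banach_open hDconv hDopen hS hdisj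
  obtain ⟨k₀, hk₀⟩ := hKi
  have hux : u ≤ f x := hfS x hx.1
  have hpos : ∀ k ∈ interior (K : Set E), 0 < f k := fun k hk => by
    have := hfD _ ⟨k, hk, rfl⟩
    rw [map_sub] at this
    linarith
  have hk₀pos : 0 < f k₀ := hpos k₀ hk₀
  refine ⟨f, ?_, ?_, ?_⟩
  · intro hf0
    rw [hf0] at hk₀pos
    simp at hk₀pos
  · intro k hk
    show 0 ≤ f k
    by_contra hneg
    push Not at hneg
    have hden : 0 < f k₀ - f k := by linarith
    set θ : ℝ := f k₀ / (f k₀ - f k) with hθ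
    have hθ0 : 0 < θ := div_pos hk₀pos hden
    have hθ1 : θ < 1 := (div_lt_one hden).mpr (by linarith)
    have hmem : (1 - θ) • k₀ + θ • k ∈ interior (K : Set E) :=
      K.convex.openSegment_interior_self_subset_interior hk₀ hk
        ⟨1 - θ, θ, by linarith, hθ0, by ring, rfl⟩
    have hval := hpos _ hmem
    simp only [map_add, map_smul, smul_eq_mul] at hval
    have hθmul : θ * (f k₀ - f k) = f k₀ := div_mul_cancel₀ _ hden.ne'
    have hzero : (1 - θ) * f k₀ + θ * f k = 0 := by linear_combination (-1 : ℝ) * hθmul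
    linarith
  · intro z hz
    have hfx : f x ≤ u := by
      refine le_of_forall_pos_lt_add fun ε hε => ?_
      have hmem : (ε / f k₀) • k₀ ∈ interior (K : Set E) :=
        cone_smul_mem_interior hk₀ (div_pos hε hk₀pos)
      have := hfD _ ⟨_, hmem, rfl⟩
      rw [map_sub, map_smul, smul_eq_mul, div_mul_cancel₀ _ hk₀pos.ne'] at this
      linarith
    exact hfx.trans (hfS z hz)

end Topological

/-! ## §3.6.2 Convexity with respect to a generalized inequality -/

section KConvex

variable {E : Type*} [AddCommGroup E] [Module ℝ E] {X : Type*} [AddCommGroup X] [Module ℝ X]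

/-- `f` is **`K`-convex** on the convex set `F`: `f(θx + (1−θ)y) ⪯_K θ f(x) + (1−θ) f(y)`
(the tree's `ConicCentralPath.KConvexOn`, stated for a `PointedCone` in a general real vector
space; see `coneConvexOn_iff_kConvexOn`). [cite: BoydVandenberghe2004, §3.6.2] -/
def ConeConvexOn (K : PointedCone ℝ E) (F : Set X) (f : X → E) : Prop :=
  Convex ℝ F ∧ ∀ ⦃x⦄, x ∈ F → ∀ ⦃y⦄, y ∈ F → ∀ ⦃a b : ℝ⦄, 0 ≤ a → 0 ≤ b → a + b = 1 →
    KLE K (f (a • x + b • y)) (a • f x + b • f y)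

variable (K : PointedCone ℝ E) {F : Set X} {f : X → E}

/-- Dual characterization of `K`-convexity, forward direction: if `f` is `K`-convex then
`wᵀf` is convex for every `w ⪰_{K*} 0`. [cite: BoydVandenberghe2004, §3.6.2] -/
theorem ConeConvexOn.convexOn_comp (hf : ConeConvexOn K F f) {φ : E →ₗ[ℝ] ℝ} (hφ : DualNonneg K φ) :
    ConvexOn ℝ F (fun x => φ (f x)) := by
  refine ⟨hf.1, fun x hx y hy a b ha hb hab => ?_⟩
  have h := (hf.2 hx hy ha hb hab).map_le K hφ
  simpa only [map_add, map_smul, smul_eq_mul] using h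

/-- Dual characterization of `K`-convexity, converse direction (closed cone, locally convex
space): if `F` is convex and `wᵀf` is convex for every continuous `w ⪰_{K*} 0`, then `f` is
`K`-convex. [cite: BoydVandenberghe2004, §3.6.2] -/
theorem coneConvexOn_of_forall_dualNonneg [TopologicalSpace E] [IsTopologicalAddGroup E]
    [ContinuousSMul ℝ E] [LocallyConvexSpace ℝ E] (hKc : IsClosed (K : Set E))
    (hF : Convex ℝ F)
    (h : ∀ φ : E →L[ℝ] ℝ, DualNonneg K (φ : E →ₗ[ℝ] ℝ) → ConvexOn ℝ F (fun x => φ (f x))) :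
    ConeConvexOn K F f := by
  refine ⟨hF, fun x hx y hy a b ha hb hab => ?_⟩
  refine kle_of_forall_dualNonneg hKc fun φ hφ => ?_
  have := (h φ hφ).2 hx hy ha hb hab
  simpa only [map_add, map_smul, smul_eq_mul] using this

/-- For a `K`-convex objective the set `A = O + K` of values worse than or equal to some
achievable value is convex ((4.62) and the sentence following it).
[cite: BoydVandenberghe2004, §4.7.4 (4.62)] -/
theorem ConeConvexOn.convex_image_add (hf : ConeConvexOn K F f) :
    Convex ℝ (f '' F + (K : Set E)) := by
  intro p hp q hq a b ha hb hab
  obtain ⟨_, ⟨x₁, hx₁, rfl⟩, k₁, hk₁, rfl⟩ := hp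
  obtain ⟨_, ⟨x₂, hx₂, rfl⟩, k₂, hk₂, rfl⟩ := hq
  refine ⟨f (a • x₁ + b • x₂), ⟨_, hf.1 hx₁ hx₂ ha hb hab, rfl⟩,
    (a • f x₁ + b • f x₂ - f (a • x₁ + b • x₂)) + (a • k₁ + b • k₂),
    add_mem (hf.2 hx₁ hx₂ ha hb hab) (add_mem (K.smul_mem ha hk₁) (K.smul_mem hb hk₂)), ?_⟩
  simp only [smul_add]
  abel

end KConvex

/-! ## §4.7.2–4.7.4 Optimal and Pareto optimal points; scalarization -/

section VectorOptimization

variable {E : Type*} [AddCommGroup E] [Module ℝ E] {X : Type*}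

/-- `x` is **optimal** for the vector optimization problem (feasible set `F`, objective `f`,
cone `K`): feasible and `f x ⪯_K f y` for every feasible `y`.
[cite: BoydVandenberghe2004, §4.7.2] -/
def IsOptimalPt (K : PointedCone ℝ E) (F : Set X) (f : X → E) (x : X) : Prop :=
  x ∈ F ∧ ∀ y ∈ F, KLE K (f x) (f y)

/-- `x` is **Pareto optimal** (efficient): feasible, and any feasible `y` with `f y ⪯_K f x`
has `f y = f x`. [cite: BoydVandenberghe2004, §4.7.3] -/
def IsParetoOptimalPt (K : PointedCone ℝ E) (F : Set X) (f : X → E) (x : X) : Prop :=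
  x ∈ F ∧ ∀ y ∈ F, KLE K (f y) (f x) → f y = f x

variable (K : PointedCone ℝ E) {F : Set X} {f : X → E} {x y : X}

/-- `x` is optimal iff it is feasible and `f x` is the minimum element of the set
`O = f '' F` of achievable objective values. [cite: BoydVandenberghe2004, §4.7.2] -/
theorem isOptimalPt_iff_isMinimumElt :
    IsOptimalPt K F f x ↔ x ∈ F ∧ IsMinimumElt K (f '' F) (f x) := by
  constructor
  · rintro ⟨hx, h⟩
    exact ⟨hx, ⟨x, hx, rfl⟩, fun _ ⟨y, hy, hyx⟩ => hyx ▸ h y hy⟩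
  · rintro ⟨hx, -, h⟩
    exact ⟨hx, fun y hy => h _ ⟨y, hy, rfl⟩⟩

/-- (4.57): `x` is optimal iff it is feasible and `O ⊆ f x + K`.
[cite: BoydVandenberghe2004, §4.7.2 (4.57)] -/
theorem isOptimalPt_iff_image_subset_vadd :
    IsOptimalPt K F f x ↔ x ∈ F ∧ f '' F ⊆ f x +ᵥ (K : Set E) := by
  rw [isOptimalPt_iff_isMinimumElt, isMinimumElt_iff_subset_vadd]
  constructor
  · rintro ⟨hx, -, h⟩
    exact ⟨hx, h⟩
  · rintro ⟨hx, h⟩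
    exact ⟨hx, ⟨x, hx, rfl⟩, h⟩

/-- The optimal value, when it exists, is unique (pointed cone): two optimal points have the
same objective value. [cite: BoydVandenberghe2004, §4.7.2] -/
theorem IsOptimalPt.apply_eq (hK : (K : ConvexCone ℝ E).Salient) (hx : IsOptimalPt K F f x)
    (hy : IsOptimalPt K F f y) : f x = f y :=
  kle_antisymm K hK (hx.2 y hy.1) (hy.2 x hx.1)

/-- `x` is Pareto optimal iff it is feasible and `f x` is a minimal element of `O = f '' F`.
[cite: BoydVandenberghe2004, §4.7.3] -/
theorem isParetoOptimalPt_iff_isMinimalElt :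
    IsParetoOptimalPt K F f x ↔ x ∈ F ∧ IsMinimalElt K (f '' F) (f x) := by
  constructor
  · rintro ⟨hx, h⟩
    exact ⟨hx, ⟨x, hx, rfl⟩, fun _ ⟨y, hy, hyx⟩ hle => hyx ▸ h y hy (hyx ▸ hle)⟩
  · rintro ⟨hx, -, h⟩
    exact ⟨hx, fun y hy hle => h _ ⟨y, hy, rfl⟩ hle⟩

/-- (4.59): `x` is Pareto optimal iff it is feasible and `(f x − K) ∩ O = {f x}`.
[cite: BoydVandenberghe2004, §4.7.3 (4.59)] -/
theorem isParetoOptimalPt_iff_inter_eq_singleton :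
    IsParetoOptimalPt K F f x ↔ x ∈ F ∧ (f x +ᵥ -(K : Set E)) ∩ f '' F = {f x} := by
  rw [isParetoOptimalPt_iff_isMinimalElt, isMinimalElt_iff_inter_eq_singleton]
  constructor
  · rintro ⟨hx, -, h⟩
    exact ⟨hx, h⟩
  · rintro ⟨hx, h⟩
    exact ⟨hx, ⟨x, hx, rfl⟩, h⟩

/-- An optimal point is Pareto optimal (pointed cone). [cite: BoydVandenberghe2004, §4.7.3] -/
theorem IsOptimalPt.isParetoOptimalPt (hK : (K : ConvexCone ℝ E).Salient)
    (hx : IsOptimalPt K F f x) : IsParetoOptimalPt K F f x :=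
  ⟨hx.1, fun y hy hyx => kle_antisymm K hK hyx (hx.2 y hy)⟩

variable {φ : E →ₗ[ℝ] ℝ}

/-- **Scalarization** (4.60): if `λ ≻_{K*} 0` and the feasible point `x` minimises the
scalarized objective `λᵀf` over the feasible set, then `x` is Pareto optimal (no convexity
needed). [cite: BoydVandenberghe2004, §4.7.4 (4.60)] -/
theorem isParetoOptimalPt_of_dualPos (hφ : DualPos K φ) (hx : x ∈ F)
    (hmin : ∀ y ∈ F, φ (f x) ≤ φ (f y)) : IsParetoOptimalPt K F f x := by
  rw [isParetoOptimalPt_iff_isMinimalElt]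
  refine ⟨hx, isMinimalElt_of_dualPos K hφ ⟨x, hx, rfl⟩ ?_⟩
  rintro _ ⟨y, hy, rfl⟩
  exact hmin y hy

/-- An optimal point minimises `λᵀf` over the feasible set for every `λ ⪰_{K*} 0`.
[cite: BoydVandenberghe2004, §4.7.4] -/
theorem IsOptimalPt.le_of_dualNonneg (hx : IsOptimalPt K F f x) (hφ : DualNonneg K φ)
    (hy : y ∈ F) : φ (f x) ≤ φ (f y) :=
  (hx.2 y hy).map_le K hφ

/-- (4.61): a minimiser `x` of the scalarized problem certifies the whole open halfspace
`{u | λᵀ(u − f x) < 0}` of objective values as unachievable.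
[cite: BoydVandenberghe2004, §4.7.4 (4.61)] -/
theorem scalarization_halfspace_inter_image_eq_empty (hmin : ∀ y ∈ F, φ (f x) ≤ φ (f y)) :
    {u : E | φ (u - f x) < 0} ∩ f '' F = ∅ := by
  refine Set.eq_empty_iff_forall_notMem.mpr ?_
  rintro _ ⟨hu, y, hy, rfl⟩
  have h := hmin y hy
  rw [Set.mem_setOf_eq, map_sub, sub_neg] at hu
  exact absurd h (not_le.mpr hu)

/-- The minimal elements of `A = O + K` include the Pareto optimal values (the direction of
exercise 4.53 used in the partial converse; pointed cone).
[cite: BoydVandenberghe2004, §4.7.4 (4.62)] -/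
theorem IsParetoOptimalPt.isMinimalElt_image_add (hK : (K : ConvexCone ℝ E).Salient)
    (hx : IsParetoOptimalPt K F f x) : IsMinimalElt K (f '' F + (K : Set E)) (f x) := by
  refine ⟨⟨f x, ⟨x, hx.1, rfl⟩, 0, K.zero_mem, add_zero _⟩, ?_⟩
  rintro _ ⟨_, ⟨y, hy, rfl⟩, k, hk, rfl⟩ hle
  dsimp only at hle ⊢
  -- `hle : f x - (f y + k) ∈ K`, hence `f y ⪯_K f x`
  have hyx : KLE K (f y) (f x) := by
    have : f x - f y = (f x - (f y + k)) + k := by abel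
    show f x - f y ∈ K
    rw [this]
    exact add_mem hle hk
  have heq : f y = f x := hx.2 y hy hyx
  rw [heq] at hle ⊢
  have hnk : -k ∈ K := by
    have h2 : f x - (f x + k) ∈ K := hle
    have : f x - (f x + k) = -k := by abel
    rwa [this] at h2
  rw [eq_zero_of_mem_of_neg_mem hK hk hnk, add_zero]

/-- **Partial converse of scalarization for convex problems**: if the objective is `K`-convex on
the convex feasible set (so `A = O + K` is convex), `K` is solid and pointed, and `x` is Pareto
optimal, then there is a nonzero continuous `λ ⪰_{K*} 0` such that `x` solves the scalarized
problem (4.60).  The weight cannot in general be taken `≻_{K*} 0`, and conversely a solution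
of the scalarized problem with a nonzero `λ ⪰_{K*} 0` need not be Pareto optimal
(`exists_dualNonneg_minimizer_not_pareto`). [cite: BoydVandenberghe2004, §4.7.4 (4.62)] -/
theorem IsParetoOptimalPt.exists_dualNonneg_scalarization [TopologicalSpace E]
    [IsTopologicalAddGroup E] [ContinuousSMul ℝ E] [Nontrivial E] [AddCommGroup X] [Module ℝ X]
    (hK : (K : ConvexCone ℝ E).Salient) (hKi : (interior (K : Set E)).Nonempty)
    (hf : ConeConvexOn K F f) (hx : IsParetoOptimalPt K F f x) :
    ∃ g : E →L[ℝ] ℝ, g ≠ 0 ∧ DualNonneg K (g : E →ₗ[ℝ] ℝ) ∧ ∀ y ∈ F, g (f x) ≤ g (f y) := by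
  obtain ⟨g, hg0, hgK, hmin⟩ :=
    (hx.isMinimalElt_image_add K hK).exists_dualNonneg hK hKi (hf.convex_image_add K)
  exact ⟨g, hg0, hgK, fun y hy => hmin _ ⟨f y, ⟨y, hy, rfl⟩, 0, K.zero_mem, add_zero _⟩⟩

end VectorOptimization

/-! ## Agreement with the inner-product-space notions of `GeneralizedInequalityCentralPath` -/

section TreeBridge

variable {V : Type*} [NormedAddCommGroup V] [InnerProductSpace ℝ V]
  {W : Type*} [NormedAddCommGroup W] [InnerProductSpace ℝ W]

/-- In a real inner product space the functional `⟪y, ·⟫` satisfies `λ ⪰_{K*} 0` in the sense of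
this file iff `y ∈ K*` in the sense of `ConicCentralPath.InDualCone` ((2.19) with the inner
product). [cite: BoydVandenberghe2004, §2.6.1 (2.19)] -/
theorem dualNonneg_innerSL_iff_inDualCone {K : PointedCone ℝ V} {y : V} :
    DualNonneg K ((innerSL ℝ y : V →L[ℝ] ℝ) : V →ₗ[ℝ] ℝ) ↔
      ConicCentralPath.InDualCone (K : Set V) y := by
  constructor
  · intro h x hx
    have := h x hx
    rwa [ContinuousLinearMap.coe_coe, innerSL_apply_apply, real_inner_comm] at this
  · intro h x hx
    rw [ContinuousLinearMap.coe_coe, innerSL_apply_apply, real_inner_comm]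
    exact h x hx

/-- `K`-convexity with respect to a pointed cone in the sense of this file is the tree's
`ConicCentralPath.KConvexOn` for the underlying set (inner-product-space setting of that file).
[cite: BoydVandenberghe2004, §3.6.2] -/
theorem coneConvexOn_iff_kConvexOn {K : PointedCone ℝ V} {D : Set W} {f : W → V} :
    ConeConvexOn K D f ↔ ConicCentralPath.KConvexOn (K : Set V) D f :=
  Iff.rfl

end TreeBridge

/-! ## §4.7.5 Multicriterion optimization (`K = ℝ^q_+`) -/

section Multicriterion

variable {ι : Type*} {X : Type*}

/-- For `K = ℝ^q_+` the generalized inequality is the componentwise order.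
[cite: BoydVandenberghe2004, §4.7.5] -/
theorem kle_positive_iff {u v : ι → ℝ} : KLE (PointedCone.positive ℝ (ι → ℝ)) u v ↔ u ≤ v := by
  simp [KLE, PointedCone.mem_positive, sub_nonneg]

/-- The nonnegative orthant is pointed (salient). [cite: BoydVandenberghe2004, §2.4.1] -/
theorem salient_positive :
    ((PointedCone.positive ℝ (ι → ℝ) : PointedCone ℝ (ι → ℝ)) : ConvexCone ℝ (ι → ℝ)).Salient := by
  intro u hu hu0 hnu
  have h1 : 0 ≤ u := hu
  have h2 : 0 ≤ -u := hnu
  exact hu0 (le_antisymm (by simpa using h2) h1)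

variable {F : Set X} {f : X → ι → ℝ} {x : X}

/-- Multicriterion Pareto optimality: `x` is Pareto optimal iff it is feasible and no feasible
`y` is at least as good in every objective and differs in some objective ("not dominated").
[cite: BoydVandenberghe2004, §4.7.5] -/
theorem isParetoOptimalPt_positive_iff :
    IsParetoOptimalPt (PointedCone.positive ℝ (ι → ℝ)) F f x ↔
      x ∈ F ∧ ∀ y ∈ F, f y ≤ f x → f y = f x := by
  simp only [IsParetoOptimalPt, kle_positive_iff]

/-- Multicriterion optimality: `x` is optimal iff it is feasible and simultaneously optimal for
each of the scalar problems `minimize Fᵢ`. [cite: BoydVandenberghe2004, §4.7.5] -/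
theorem isOptimalPt_positive_iff :
    IsOptimalPt (PointedCone.positive ℝ (ι → ℝ)) F f x ↔
      x ∈ F ∧ ∀ i, ∀ y ∈ F, f x i ≤ f y i := by
  simp only [IsOptimalPt, kle_positive_iff, Pi.le_def]
  exact and_congr_right fun _ => ⟨fun h i y hy => h y hy i, fun h y hy i => h i y hy⟩

variable [Fintype ι]

/-- The weighted-sum functional `u ↦ λᵀu = ∑ᵢ λᵢ uᵢ` on `ℝ^q`.
[cite: BoydVandenberghe2004, §4.7.5] -/
def weightedSum (w : ι → ℝ) : (ι → ℝ) →ₗ[ℝ] ℝ := ∑ i, w i • LinearMap.proj i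

/-- [cite: BoydVandenberghe2004, §4.7.5] -/
@[simp] theorem weightedSum_apply (w u : ι → ℝ) : weightedSum w u = ∑ i, w i * u i := by
  simp [weightedSum, LinearMap.sum_apply]

/-- `λ ⪰_{K*} 0` for `K = ℝ^q_+` iff every weight is nonnegative (the orthant is self-dual).
[cite: BoydVandenberghe2004, §4.7.5] -/
theorem dualNonneg_positive_iff [DecidableEq ι] {w : ι → ℝ} :
    DualNonneg (PointedCone.positive ℝ (ι → ℝ)) (weightedSum w) ↔ ∀ i, 0 ≤ w i := by
  constructor
  · intro h i
    have := h (Pi.single i 1) (by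
      show (0 : ι → ℝ) ≤ Pi.single i 1
      exact Pi.single_nonneg.mpr zero_le_one)
    simpa [Pi.single_apply] using this
  · intro h u hu
    have hu' : 0 ≤ u := hu
    rw [weightedSum_apply]
    exact Finset.sum_nonneg fun i _ => mul_nonneg (h i) (hu' i)

/-- `λ ≻_{K*} 0` for `K = ℝ^q_+` iff every weight is positive.
[cite: BoydVandenberghe2004, §4.7.5] -/
theorem dualPos_positive_iff [DecidableEq ι] {w : ι → ℝ} :
    DualPos (PointedCone.positive ℝ (ι → ℝ)) (weightedSum w) ↔ ∀ i, 0 < w i := by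
  constructor
  · intro h i
    have := h (Pi.single i 1) (by
      show (0 : ι → ℝ) ≤ Pi.single i 1
      exact Pi.single_nonneg.mpr zero_le_one) (by simp)
    simpa [Pi.single_apply] using this
  · intro h u hu hu0
    have hu' : 0 ≤ u := hu
    obtain ⟨j, hj⟩ : ∃ j, u j ≠ 0 := by
      by_contra hall
      push Not at hall
      exact hu0 (funext hall)
    rw [weightedSum_apply]
    refine Finset.sum_pos' (fun i _ => mul_nonneg (h i).le (hu' i)) ⟨j, Finset.mem_univ j, ?_⟩
    exact mul_pos (h j) (lt_of_le_of_ne (hu' j) (Ne.symm hj))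

/-- Scalarization for multicriterion problems: a feasible minimiser of `∑ᵢ λᵢ Fᵢ` with all
weights `λᵢ > 0` is Pareto optimal. [cite: BoydVandenberghe2004, §4.7.5] -/
theorem isParetoOptimalPt_positive_of_weights [DecidableEq ι] {w : ι → ℝ} (hw : ∀ i, 0 < w i)
    (hx : x ∈ F) (hmin : ∀ y ∈ F, ∑ i, w i * f x i ≤ ∑ i, w i * f y i) :
    IsParetoOptimalPt (PointedCone.positive ℝ (ι → ℝ)) F f x :=
  isParetoOptimalPt_of_dualPos _ (dualPos_positive_iff.mpr hw) hx (by simpa using hmin)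

/-- The caveat of §4.7.4: a solution of the scalarized problem with a nonzero weight
`λ ⪰_{K*} 0` (here `λ = (0, 1)`, `K = ℝ²_+`) need not be Pareto optimal — for the bicriterion
problem `f(t) = (t, 0)` over `t ∈ [0, 1]` every feasible point minimises `λᵀf`, but `t = 1` is
dominated by `t = 0`. [cite: BoydVandenberghe2004, §4.7.4] -/
theorem exists_dualNonneg_minimizer_not_pareto :
    ∃ (F : Set ℝ) (f : ℝ → Fin 2 → ℝ) (w : Fin 2 → ℝ) (x : ℝ),
      (∀ i, 0 ≤ w i) ∧ w ≠ 0 ∧ x ∈ F ∧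
      (∀ y ∈ F, weightedSum w (f x) ≤ weightedSum w (f y)) ∧
      ¬ IsParetoOptimalPt (PointedCone.positive ℝ (Fin 2 → ℝ)) F f x := by
  refine ⟨Set.Icc 0 1, fun t => ![t, 0], ![0, 1], 1, ?_, ?_, by norm_num, ?_, ?_⟩
  · intro i
    fin_cases i <;> simp
  · intro h
    have := congr_fun h 1
    simp at this
  · intro y hy
    simp [Fin.sum_univ_two]
  · rw [isParetoOptimalPt_positive_iff]
    rintro ⟨-, h⟩
    have h0 := h 0 (by norm_num) (by
      intro i
      fin_cases i <;> simp)
    have := congr_fun h0 0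
    simp at this

end Multicriterion

end Literature.Analysis.Convex.VectorOptimizationScalarization
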